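import Literature.AlgebraicGeometry.AbelianSchemes.AbelianSchemeConstSubgroupQuotientSmooth
import Literature.AlgebraicGeometry.Morphisms.SmoothOfAffineFlatSurjectiveSmoothComp
import HarnessLib

/-!
# The quotient `A/K` of an abelian scheme by a free finite group of translations is SMOOTH over ANY locally Noetherian base

Layer `Literature/AlgebraicGeometry/AbelianSchemes`, namespace `Literature.AlgebraicGeometry.AbelianSchemes.AbelianSchemeOver`.
Cell `hodgecm-mathlib` (D-0151), P6 «MOD programme», deal (s2-D) organ (P3) (LEAD F0P6-plan (g2) M-25 / M-28; prover seat B-p04 (g39)).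
THEOREMS ONLY (no definition, no instance, no named fact, no `sorry`); ★ `AbelianSchemeConstSubgroupQuotientSmooth` untouched.

★ `smooth_quotientOver_hom` proves `Smooth (A/K → S)` over a locally Noetherian base WITH PERFECT RESIDUE FIELDS (regular-fibre
criterion EGA IV₄ 17.5.1), and ★ `MumfordQuotientConstruction.exists_quotient_poincare_of_constant_sections` therefore carries
`[CharZero k]`.  Over the `p`-integral spread stages of the (s2-D) road the residue fields at non-closed points of the special fibre are
NOT perfect; this file removes the hypothesis: the quotient map `ψ : A → A/K` is AFFINE, flat (free action, Mumford §12 Thm. 1),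
surjective and of finite presentation, so smoothness of `A → S` descends to `A/K → S` by EGA IV₄ 17.7.7 for an affine faithfully flat
cover of the source (★ `Morphisms.smooth_of_affine_flat_surjective_of_smooth_comp`, Stacks 05B5 — the SMOOTH-fibre criterion, any
characteristic).
* **`smooth_quotientOver_hom_of_isLocallyNoetherian`** — `Smooth (A.quotientOver u K).hom` for `S` locally Noetherian, `K` finite acting
  freely on geometric points (`hfree`), with the standing separatedness / affine-cover hypotheses of ★ `quotientOver`.
HC_CM is proved only modulo the 2 remaining named inputs (hLiu418, h413); this file asserts nothing about HC and is count-neutral.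

## References
* [MumfordAV1970] D. Mumford, *Abelian Varieties* (1970), §7 Thm. 4 (p. 72); §12 Thm. 1 (p. 112).
* [Grothendieck1967] A. Grothendieck, *EGA IV₄* (1967), Prop. 17.7.7.
* [StacksProject] The Stacks Project, Tag 05B5, Tag 02JZ.
-/

set_option autoImplicit false

noncomputable section

universe u

open CategoryTheory CategoryTheory.Limits AlgebraicGeometry

namespace Literature.AlgebraicGeometry.AbelianSchemes

namespace AbelianSchemeOver

open MonoidalCategory CartesianMonoidalCategory
open scoped MonObj

variable {S : Scheme.{u}} (A : AbelianSchemeOver S) {Y : Scheme.{u}} (u : S ⟶ Y) (K : Subgroup A.Sections)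
  [Finite K] [Y.IsSeparated] [IsSeparated (A.X.hom ≫ u)] [S.IsSeparated]
  (hcov : ∀ x : A.left, ∃ O : (A.translationActionOver u K).StableAffineOpens, x ∈ O.1)

include hcov in
/-- **`A/K → S` is SMOOTH over ANY locally Noetherian base** — ★ `smooth_quotientOver_hom` with its hypothesis «perfect residue
fields» REMOVED: `ψ : A → A/K` is affine (★ `isAffineHom_quotientMk_left`), flat (★ `flat_quotientMk_left`, free action), surjective,
locally of finite presentation (finite type over the locally Noetherian `A/K`), `A/K → S` is locally of finite presentation (★) and
`ψ ≫ (A/K → S) = (A → S)` is smooth, so EGA IV₄ 17.7.7 for an affine cover of the source (★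
`Morphisms.smooth_of_affine_flat_surjective_of_smooth_comp`, Stacks 05B5) gives smoothness — no regular-fibre criterion, no perfectness.
[cite: MumfordAV1970, §7 Thm. 4 (p. 72)] [cite: Grothendieck1967, Prop. 17.7.7] [cite: StacksProject, Tag 05B5] -/
theorem smooth_quotientOver_hom_of_isLocallyNoetherian [IsAffine Y] [LocallyOfFiniteType (A.X.hom ≫ u)] [IsLocallyNoetherian Y]
    [IsLocallyNoetherian S]
    (hfree : ∀ (Ω : Type u) [Field Ω] [IsAlgClosed Ω] (x : Spec (.of Ω) ⟶ A.left) (σ : K), σ ≠ 1 →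
      x ≫ (A.translation (σ : A.Sections)).left ≠ x) : Smooth (A.quotientOver u K).hom := by
  haveI := A.flat_quotientMk_left u K hcov hfree
  haveI := A.surjective_quotientMk_left u K hcov
  haveI := A.isAffineHom_quotientMk_left u K hcov
  haveI := A.locallyOfFiniteType_quotientOver_hom u K hcov
  haveI := A.locallyOfFinitePresentation_quotientOver_hom u K hcov
  haveI : Smooth A.X.hom := A.isSmooth
  haveI : IsLocallyNoetherian (A.quotientOver u K).left := LocallyOfFiniteType.isLocallyNoetherian (A.quotientOver u K).hom
  haveI : LocallyOfFiniteType ((A.quotientMk u K hcov).left ≫ (A.quotientOver u K).hom) := by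
    rw [Over.w]; infer_instance
  haveI : LocallyOfFiniteType (A.quotientMk u K hcov).left := locallyOfFiniteType_of_comp _ (A.quotientOver u K).hom
  haveI : LocallyOfFinitePresentation (A.quotientMk u K hcov).left := inferInstance
  exact Morphisms.smooth_of_affine_flat_surjective_of_smooth_comp (A.quotientMk u K hcov).left (A.quotientOver u K).hom
    A.X.hom (Over.w _)

end AbelianSchemeOver

end Literature.AlgebraicGeometry.AbelianSchemes

end
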